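import Literature.IUT.HodgeTheaters.Cor53iFcircHdescOfAutCompatible
import Literature.IUT.HodgeTheaters.Cor53iFcircHdescNotAtFstCarrier
import HarnessLib

/-!
# [IUTchI] Cor 5.3 (i) «respectively ⊚»: the descent binder `hdesc⊚` is EQUIVALENT to the law `AutCompatible ι` at every push
# carrier — the push-forward half of the [SemiAnbd] Prop 3.2 dictionary

S. Mochizuki, *Inter-universal Teichmüller theory I*, kurims manuscript (May 2020), §5 Cor 5.3 (i) p. 144 l. 2–11, proof l. 24–28;
Example 5.1 (i) p. 123 l. 33–38 (`π₁(†𝒟^⊚) ↪ π₁(†𝒟^⊛)` an open injection, `†𝒟^⊚ → †𝒟^⊛` its push-forward), (iii) pp. 125–126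
([IUTchI] Cor 5.3 (i) p.144) [claim: Mochizuki2012, status: disputed] (D-0012 claim key; nothing of the series is asserted; no side
taken on [IUTchIII] Cor. 3.12).  [SemiAnbd] Prop 3.2 p. 35 («isomorphism classes of morphisms `𝒯₁ → 𝒯₂`» = «outer homomorphisms
`Π₁ → Π₂`») [cite: MochizukiSemiAnbd2006, Prop 3.2 p.35]; [FrdII] Ex 1.3 (ii) p. 11 (`φ_*`, pull-back) [cite: MochizukiFrdII2008, Ex 1.3 (ii) p.11].

PROOF-ONLY (cell abc-iut, seat abc-iut-L5-t4 gen 11, row «HDESC⊚-IFF-AUTCOMPATIBLE + NORMAL-NECESSARY@OPEN-EMBEDDING» FILE A;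
0 def · 0 instance · 0 notation · no Prop fact).  ★ `Cor53iFcircHdescOfAutCompatible` REDUCED abc-iut-w4-d109's displayed binder
`hdesc⊚` («every self-equivalence of `†𝒟^⊚` descends along `†𝒟^⊚ → †𝒟^⊛`») to the law
`AutCompatible ι` :≡ `∀ φ : Π ≃ₜ* Π, ∃ (φ₀ : G ≃ₜ* G) (g : G), ∀ x, ι (φ x) = g * φ₀ (ι x) * g⁻¹`.  THIS FILE proves the CONVERSE:
* §1 `CosetCat.exists_forall_conj_of_push_iso_push` — `push ι₁ ≅ push ι₂ ⟹ ι₁ = Inn(g) ∘ ι₂` (open `ι₁, ι₂ : Π → G`, `ι₂` continuous,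
  `G` tempered): the PUSH half of the [SemiAnbd] Prop 3.2 dictionary (abc-iut-L5-t2's ★ `exists_forall_conj_of_pull_iso_pull` is the
  pull half; same gluing by completeness/separatedness, at the objects `Π/ι₂⁻¹(M)`, `M ⊆ G` open normal; no surjectivity/injectivity);
* §2 absorption isomorphisms `pull ψ⁻¹ ⋙ push ι ≅ push (ι ∘ ψ)`, `push ι ⋙ pull β⁻¹ ≅ push (β ∘ ι)`; **`CosetCat.exists_conj_of_pull_symm_push_descends`**
  (if `pull ψ⁻¹` descends along `push ι` to some `Θ₀`, then `ι ∘ ψ = Inn(g) ∘ φ₀ ∘ ι` with `Θ₀ ≅ pull φ₀⁻¹`, t2's ★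
  `exists_continuousMulEquiv_nonempty_iso_pull`); **`CosetCat.autCompatible_of_forall_push_descends`** — converse of ★
  `exists_push_descends_of_autCompatible`;
* §3 **`GlobalFrobenioid.autCompatible_of_hdesc`** and **`GlobalFrobenioid.hdesc_iff_autCompatible`** (data `e`, `i`, `hinst` exactly as
  ★ `hdesc_of_autCompatible`): `hdesc⊚ ⟺ AutCompatible ι`.  FILE B (`Cor53iFcircHdescNotAtNormalClosureCarrier`) specialises to the
  literal push carrier and shows `hdesc⊚` FAILS at an open-EMBEDDING carrier when `F/ℚ` is not normal.
HONEST LABEL: an equivalence of OUR displayed binders at OUR carriers; it discharges nothing in print's sense (print's surjectivity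
is functorial reconstruction); typed ≠ inhabited ≠ proved; nothing here asserts abc proved or refuted. -/

noncomputable section

namespace Literature.AnabelianGeometry.SemiGraphs

namespace CosetCat
open CategoryTheory Function Literature.AlgebraicGeometry.Frobenioids
open Literature.AlgebraicGeometry.Frobenioids.BaseGaloisSystem

universe u
variable {P : Type u} [Group P] [TopologicalSpace P] {G : Type u} [Group G] [TopologicalSpace G]

/-! ### §1. Isomorphic push-forward functors differ by an inner automorphism ([SemiAnbd] Prop 3.2, push half) -/

/-- **Isomorphic push-forward functors differ by an inner automorphism** (`G` tempered, `ι₂` continuous): `push ι₁ ≅ push ι₂`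
forces `ι₁ = Inn(g) ∘ ι₂` — the push half of «isomorphism classes of functors = conjugacy classes of homomorphisms» (pull half: ★
`exists_forall_conj_of_pull_iso_pull`).  Components at `Π/ι₂⁻¹(M)`, `M ⊆ G` open normal, are cosets `a_M`; naturality at right
translations and projections gives a compatible family with `a_M⁻¹ ι₁(p) a_M ≡ ι₂(p) (mod M)`; completeness glues, separatedness
concludes.  No surjectivity or injectivity of `ι₁, ι₂` is needed. [cite: MochizukiSemiAnbd2006, Prop 3.2 p.35] -/
theorem exists_forall_conj_of_push_iso_push (hG : IsTempered G) (ι₁ ι₂ : P →* G) (ho₁ : IsOpenMap ι₁)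
    (ho₂ : IsOpenMap ι₂) (hc₂ : Continuous ι₂) (h : Nonempty (push ι₁ ho₁ ≅ push ι₂ ho₂)) :
    ∃ g : G, ∀ p : P, ι₁ p = g * ι₂ p * g⁻¹ := by
  obtain ⟨σ⟩ := h
  -- the open normal subgroups `ι₂⁻¹(M)` of `Π`
  let N : OpenNormalSubgroup G → OpenNormalSubgroup P := fun M =>
    { toOpenSubgroup := M.toOpenSubgroup.comap ι₂ hc₂
      isNormal' := Subgroup.Normal.comap M.isNormal' ι₂ }
  have hNmem : ∀ (M : OpenNormalSubgroup G) (π : P), π ∈ (N M).toOpenSubgroup ↔ ι₂ π ∈ M := fun M π =>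
    OpenSubgroup.mem_comap (hf := hc₂)
  have hNmono : ∀ {M M' : OpenNormalSubgroup G}, M ≤ M' → N M ≤ N M' := fun h π hπ => (hNmem _ π).mpr (h ((hNmem _ π).mp hπ))
  -- `ι₂(ι₂⁻¹ M) ⊆ M`
  have hsub : ∀ (M : OpenNormalSubgroup G) (x : G), x ∈ ((push ι₂ ho₂).obj (cQ (N M))).sg → x ∈ M := by
    intro M x hx
    obtain ⟨π, hπ, rfl⟩ := (mem_mapOpen ι₂ ho₂).mp hx
    exact (hNmem M π).mp hπ
  -- representatives `a M ∈ G` of the points of the components of `σ`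
  have hrep : ∀ M : OpenNormalSubgroup G, ∃ aM : G,
      pt (σ.hom.app (cQ (N M))) = (aM : ((push ι₂ ho₂).obj (cQ (N M))).carrier) := fun M =>
    (QuotientGroup.mk_surjective (pt (σ.hom.app (cQ (N M))))).imp fun _ h => h.symm
  choose a ha using hrep
  -- (F1) `a_M⁻¹ ι₁(p) a_M ≡ ι₂(p) (mod M)`: naturality of `σ` at the right translation by `p` of `Π/ι₂⁻¹(M)`
  have hF1 : ∀ (M : OpenNormalSubgroup G) (p : P),
      (((a M)⁻¹ * ι₁ p * a M : G) : G ⧸ M.toSubgroup) = (ι₂ p : G ⧸ M.toSubgroup) := by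
    intro M p
    have hnat := congrArg pt (σ.hom.naturality (crightMul (N M) p))
    rw [pt_comp, pt_comp, pt_push_map, pt_crightMul, pushQuot_coe, toFun_coe, ha M, toFun_coe, pt_push_map,
      pt_crightMul, pushQuot_coe, MulAction.Quotient.smul_coe, MulAction.Quotient.smul_coe, smul_eq_mul, smul_eq_mul,
      QuotientGroup.eq] at hnat
    have hmem : (ι₁ p * a M)⁻¹ * (a M * ι₂ p) ∈ M := hsub M _ hnat
    rw [QuotientGroup.eq, show ((a M)⁻¹ * ι₁ p * a M)⁻¹ * ι₂ p = (ι₁ p * a M)⁻¹ * (a M * ι₂ p) by group]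
    exact hmem
  -- (F2) compatibility of the `a_M` along the projections
  have hF2 : ∀ (M M' : OpenNormalSubgroup G), M ≤ M' →
      ((a M' : G) : G ⧸ M'.toSubgroup) = (a M : G ⧸ M'.toSubgroup) := by
    intro M M' hMM'
    have hnat := congrArg pt (σ.hom.naturality (cproj (hNmono hMM')))
    rw [pt_comp, pt_comp, pt_push_map, pt_cproj, pushQuot_coe, map_one, toFun_coe, one_smul, ha M', ha M, toFun_coe,
      pt_push_map, pt_cproj, pushQuot_coe, map_one, MulAction.Quotient.smul_coe, smul_eq_mul, mul_one,
      QuotientGroup.eq] at hnat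
    rw [QuotientGroup.eq]
    exact hsub M' _ hnat
  -- glue the `a_M` by completeness of `G`
  obtain ⟨b, hb⟩ := hG.complete (fun M => (a M : G ⧸ M.toSubgroup)) (by
    intro M M' hMM' g hg
    rw [hF2 M M' hMM']
    rw [QuotientGroup.eq] at hg ⊢
    exact hMM' hg)
  -- `b⁻¹ ι₁(p) b = ι₂(p)`: congruent modulo every `M`, then separatedness
  have key : ∀ p : P, b⁻¹ * ι₁ p * b = ι₂ p := by
    intro p
    have hmod : ∀ M : OpenNormalSubgroup G,
        ((b⁻¹ * ι₁ p * b : G) : G ⧸ M.toSubgroup) = (ι₂ p : G ⧸ M.toSubgroup) := by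
      intro M
      haveI : M.toSubgroup.Normal := M.isNormal'
      rw [← hF1 M p, QuotientGroup.mk_mul, QuotientGroup.mk_mul, QuotientGroup.mk_inv, ← hb M,
        ← QuotientGroup.mk_inv, ← QuotientGroup.mk_mul, ← QuotientGroup.mk_mul]
    by_contra hne
    obtain ⟨M, hM⟩ := hG.separated ((b⁻¹ * ι₁ p * b)⁻¹ * ι₂ p) fun h1 => hne (inv_mul_eq_one.mp h1)
    exact hM (QuotientGroup.eq.mp (hmod M))
  exact ⟨b, fun p => by rw [← key p]; group⟩

/-! ### §2. Absorbing a topological automorphism into `push`; the CONVERSE: descent of `pull ψ⁻¹` forces `AutCompatible` -/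

/-- **`pull ψ⁻¹ ⋙ push ι ≅ push (ι ∘ ψ)`** for an open homomorphism `ι : Π → G` and a topological automorphism `ψ` of `Π`: both send
`Π/U` to `G/ι(ψU)`, components `1 ↦ 1`. [cite: MochizukiFrdII2008, Ex 1.3 (ii) p.11] -/
theorem nonempty_pull_symm_push_iso_push_comp (ι : P →* G) (ho : IsOpenMap ι) (ψ : P ≃ₜ* P)
    (hcψ : Continuous ψ.symm.toMonoidHom) (hsψ : Function.Surjective ψ.symm.toMonoidHom)
    (ho' : IsOpenMap (ι.comp ψ.toMonoidHom)) :
    Nonempty (pull ψ.symm.toMonoidHom hcψ hsψ ⋙ push ι ho ≅ push (ι.comp ψ.toMonoidHom) ho') := by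
  have hmem : ∀ (X : CosetCat P) (y : G),
      y ∈ ((push ι ho).obj ((pull ψ.symm.toMonoidHom hcψ hsψ).obj X)).sg ↔ y ∈ ((push (ι.comp ψ.toMonoidHom) ho').obj X).sg := by
    intro X y
    change y ∈ mapOpen ι ho (X.sg.comap ψ.symm.toMonoidHom hcψ) ↔ y ∈ mapOpen (ι.comp ψ.toMonoidHom) ho' X.sg
    rw [mem_mapOpen, mem_mapOpen]
    constructor
    · rintro ⟨π, hπ, rfl⟩
      refine ⟨ψ.symm π, hπ, ?_⟩
      change ι (ψ (ψ.symm π)) = ι π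
      rw [ContinuousMulEquiv.apply_symm_apply]
    · rintro ⟨u, hu, rfl⟩
      refine ⟨ψ u, ?_, rfl⟩
      change ψ.symm (ψ u) ∈ X.sg
      rwa [ContinuousMulEquiv.symm_apply_apply]
  have hfix : ∀ X : CosetCat P, ∀ u ∈ ((push ι ho).obj ((pull ψ.symm.toMonoidHom hcψ hsψ).obj X)).sg,
      u • ((1 : G) : ((push (ι.comp ψ.toMonoidHom) ho').obj X).carrier) =
        ((1 : G) : ((push (ι.comp ψ.toMonoidHom) ho').obj X).carrier) :=
    fun X u hu => (smul_one_eq_one_iff _ u).mpr ((hmem X u).mp hu)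
  have hfix' : ∀ X : CosetCat P, ∀ u ∈ ((push (ι.comp ψ.toMonoidHom) ho').obj X).sg,
      u • ((1 : G) : ((push ι ho).obj ((pull ψ.symm.toMonoidHom hcψ hsψ).obj X)).carrier) =
        ((1 : G) : ((push ι ho).obj ((pull ψ.symm.toMonoidHom hcψ hsψ).obj X)).carrier) :=
    fun X u hu => (smul_one_eq_one_iff _ u).mpr ((hmem X u).mpr hu)
  have hnat : ∀ {X Y : CosetCat P} (f : X ⟶ Y),
      (push ι ho).map ((pull ψ.symm.toMonoidHom hcψ hsψ).map f) ≫ homMk _ (hfix Y) =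
        homMk _ (hfix X) ≫ (push (ι.comp ψ.toMonoidHom) ho').map f := by
    intro X Y f
    obtain ⟨a, ha⟩ := Quotient.exists_rep (pt f)
    have ha' : pt f = ((a : P) : Y.carrier) := ha.symm
    have hψa : ψ.symm.toMonoidHom (ψ a) = a := ψ.symm_apply_apply a
    refine hom_ext ?_
    rw [pt_comp, pt_push_map, pt_pull_map_coe ψ.symm.toMonoidHom _ _ f ha' hψa, pushQuot_coe, homMk_toFun_coe,
      MulAction.Quotient.smul_coe, smul_eq_mul, mul_one, pt_comp, pt_homMk, toFun_coe, one_smul, pt_push_map, ha',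
      pushQuot_coe]
    rfl
  have hhi : ∀ X : CosetCat P, homMk _ (hfix X) ≫ homMk _ (hfix' X) =
      𝟙 ((push ι ho).obj ((pull ψ.symm.toMonoidHom hcψ hsψ).obj X)) := fun X =>
    hom_ext (by rw [pt_comp, pt_homMk, homMk_toFun_coe, one_smul, pt_id])
  have hih : ∀ X : CosetCat P, homMk _ (hfix' X) ≫ homMk _ (hfix X) =
      𝟙 ((push (ι.comp ψ.toMonoidHom) ho').obj X) := fun X =>
    hom_ext (by rw [pt_comp, pt_homMk, homMk_toFun_coe, one_smul, pt_id])
  exact ⟨NatIso.ofComponents (fun X =>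
    { hom := homMk _ (hfix X)
      inv := homMk _ (hfix' X)
      hom_inv_id := hhi X
      inv_hom_id := hih X }) (fun f => hnat f)⟩

/-- **`push ι ⋙ pull β⁻¹ ≅ push (β ∘ ι)`** for an open homomorphism `ι : Π → G` and a topological automorphism `β` of `G`: both send
`Π/U` to `G/β(ιU)`, components `1 ↦ 1`. [cite: MochizukiFrdII2008, Ex 1.3 (ii) p.11] -/
theorem nonempty_push_pull_symm_iso_push_comp (ι : P →* G) (ho : IsOpenMap ι) (β : G ≃ₜ* G)
    (hcβ : Continuous β.symm.toMonoidHom) (hsβ : Function.Surjective β.symm.toMonoidHom)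
    (ho' : IsOpenMap (β.toMonoidHom.comp ι)) :
    Nonempty (push ι ho ⋙ pull β.symm.toMonoidHom hcβ hsβ ≅ push (β.toMonoidHom.comp ι) ho') := by
  have hmem : ∀ (X : CosetCat P) (y : G),
      y ∈ ((pull β.symm.toMonoidHom hcβ hsβ).obj ((push ι ho).obj X)).sg ↔ y ∈ ((push (β.toMonoidHom.comp ι) ho').obj X).sg := by
    intro X y
    change β.symm.toMonoidHom y ∈ mapOpen ι ho X.sg ↔ y ∈ mapOpen (β.toMonoidHom.comp ι) ho' X.sg
    rw [mem_mapOpen, mem_mapOpen]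
    constructor
    · rintro ⟨u, hu, hu'⟩
      refine ⟨u, hu, ?_⟩
      change β (ι u) = y
      rw [hu']
      exact β.apply_symm_apply y
    · rintro ⟨u, hu, rfl⟩
      exact ⟨u, hu, (β.symm_apply_apply (ι u)).symm⟩
  have hfix : ∀ X : CosetCat P, ∀ u ∈ ((pull β.symm.toMonoidHom hcβ hsβ).obj ((push ι ho).obj X)).sg,
      u • ((1 : G) : ((push (β.toMonoidHom.comp ι) ho').obj X).carrier) =
        ((1 : G) : ((push (β.toMonoidHom.comp ι) ho').obj X).carrier) :=
    fun X u hu => (smul_one_eq_one_iff _ u).mpr ((hmem X u).mp hu)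
  have hfix' : ∀ X : CosetCat P, ∀ u ∈ ((push (β.toMonoidHom.comp ι) ho').obj X).sg,
      u • ((1 : G) : ((pull β.symm.toMonoidHom hcβ hsβ).obj ((push ι ho).obj X)).carrier) =
        ((1 : G) : ((pull β.symm.toMonoidHom hcβ hsβ).obj ((push ι ho).obj X)).carrier) :=
    fun X u hu => (smul_one_eq_one_iff _ u).mpr ((hmem X u).mpr hu)
  have hnat : ∀ {X Y : CosetCat P} (f : X ⟶ Y),
      (pull β.symm.toMonoidHom hcβ hsβ).map ((push ι ho).map f) ≫ homMk _ (hfix Y) =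
        homMk _ (hfix X) ≫ (push (β.toMonoidHom.comp ι) ho').map f := by
    intro X Y f
    obtain ⟨a, ha⟩ := Quotient.exists_rep (pt f)
    have ha' : pt f = ((a : P) : Y.carrier) := ha.symm
    have hβa : β.symm.toMonoidHom (β (ι a)) = ι a := β.symm_apply_apply (ι a)
    have hpush : pt ((push ι ho).map f) = ((ι a : G) : ((push ι ho).obj Y).carrier) := by
      rw [pt_push_map, ha', pushQuot_coe]
    refine hom_ext ?_
    rw [pt_comp, pt_pull_map_coe β.symm.toMonoidHom _ _ ((push ι ho).map f) hpush hβa, homMk_toFun_coe,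
      MulAction.Quotient.smul_coe, smul_eq_mul, mul_one, pt_comp, pt_homMk, toFun_coe, one_smul, pt_push_map, ha',
      pushQuot_coe]
    rfl
  have hhi : ∀ X : CosetCat P, homMk _ (hfix X) ≫ homMk _ (hfix' X) =
      𝟙 ((pull β.symm.toMonoidHom hcβ hsβ).obj ((push ι ho).obj X)) := fun X =>
    hom_ext (by rw [pt_comp, pt_homMk, homMk_toFun_coe, one_smul, pt_id])
  have hih : ∀ X : CosetCat P, homMk _ (hfix' X) ≫ homMk _ (hfix X) =
      𝟙 ((push (β.toMonoidHom.comp ι) ho').obj X) := fun X =>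
    hom_ext (by rw [pt_comp, pt_homMk, homMk_toFun_coe, one_smul, pt_id])
  exact ⟨NatIso.ofComponents (fun X =>
    { hom := homMk _ (hfix X)
      inv := homMk _ (hfix' X)
      hom_inv_id := hhi X
      inv_hom_id := hih X }) (fun f => hnat f)⟩

/-- **Converse of ★ `nonempty_pull_symm_push_iso_push_pull_symm_of_conj`**: if `pull ψ⁻¹` DESCENDS along `push ι` to a self-equivalence
`Θ₀` of `CosetCat G` (`G` Galois-countable tempered, `ι` continuous open), then `ι (ψ x) = g · φ₀ (ι x) · g⁻¹` for a topological
automorphism `φ₀` of `G` (`Θ₀ ≅ pull φ₀⁻¹`, ★ `exists_continuousMulEquiv_nonempty_iso_pull`) and some `g` (§1 on `push (ι∘ψ) ≅ push (φ₀∘ι)`).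
[cite: MochizukiSemiAnbd2006, Prop 3.2 p.35] -/
theorem exists_conj_of_pull_symm_push_descends [IsTopologicalGroup G] [SecondCountableTopology G] (hG : IsTempered G)
    (ι : P →* G) (ho : IsOpenMap ι) (hc : Continuous ι)
    (ψ : P ≃ₜ* P) (hcψ : Continuous ψ.symm.toMonoidHom) (hsψ : Function.Surjective ψ.symm.toMonoidHom)
    (Θ₀ : CosetCat G ≌ CosetCat G)
    (h : Nonempty (pull ψ.symm.toMonoidHom hcψ hsψ ⋙ push ι ho ≅ push ι ho ⋙ Θ₀.functor)) :
    ∃ (φ₀ : G ≃ₜ* G) (g : G), ∀ x, ι (ψ x) = g * φ₀ (ι x) * g⁻¹ := by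
  obtain ⟨sq⟩ := h
  obtain ⟨φ₀, hcφ, hsφ, ⟨j⟩⟩ := exists_continuousMulEquiv_nonempty_iso_pull hG hG Θ₀
  have hoψ : IsOpenMap (ι.comp ψ.toMonoidHom) := ho.comp ψ.toHomeomorph.isOpenMap
  have hoφ : IsOpenMap (φ₀.toMonoidHom.comp ι) := φ₀.toHomeomorph.isOpenMap.comp ho
  obtain ⟨ia⟩ := nonempty_pull_symm_push_iso_push_comp ι ho ψ hcψ hsψ hoψ
  obtain ⟨ib⟩ := nonempty_push_pull_symm_iso_push_comp ι ho φ₀ hcφ hsφ hoφ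
  obtain ⟨g, hg⟩ := exists_forall_conj_of_push_iso_push hG (ι.comp ψ.toMonoidHom) (φ₀.toMonoidHom.comp ι) hoψ hoφ
    (φ₀.continuous.comp hc) ⟨ia.symm ≪≫ sq ≪≫ Functor.isoWhiskerLeft (push ι ho) j ≪≫ ib⟩
  exact ⟨φ₀, g, fun x => hg x⟩

/-- **`AutCompatible ι` is NECESSARY for descent along `push ι`** (`G` Galois-countable tempered, `ι` continuous open): if every
self-equivalence of `CosetCat Π` descends along `push ι`, every topological automorphism of `Π` extends along `ι` up to `Inn(G)` —
the converse of ★ `exists_push_descends_of_autCompatible`. [cite: MochizukiSemiAnbd2006, Prop 3.2 p.35] -/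
theorem autCompatible_of_forall_push_descends [IsTopologicalGroup G] [SecondCountableTopology G] (hG : IsTempered G)
    (ι : P →* G) (ho : IsOpenMap ι) (hc : Continuous ι)
    (hdesc : ∀ Θ : CosetCat P ≌ CosetCat P, ∃ Θ₀ : CosetCat G ≌ CosetCat G,
      Nonempty (Θ.functor ⋙ push ι ho ≅ push ι ho ⋙ Θ₀.functor)) :
    ∀ φ : P ≃ₜ* P, ∃ (φ₀ : G ≃ₜ* G) (g : G), ∀ x, ι (φ x) = g * φ₀ (ι x) * g⁻¹ := by
  intro φ
  haveI := pull_isEquivalence_of_continuousMulEquiv φ.symm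
  obtain ⟨Θ₀, h⟩ := hdesc (pull φ.symm.toMonoidHom φ.symm.continuous φ.symm.surjective).asEquivalence
  exact exists_conj_of_pull_symm_push_descends hG ι ho hc φ φ.symm.continuous φ.symm.surjective Θ₀ h

end CosetCat

end Literature.AnabelianGeometry.SemiGraphs

namespace Literature.IUT.HodgeTheaters

open CategoryTheory Function Literature.AlgebraicGeometry.Frobenioids Literature.AnabelianGeometry.SemiGraphs
open Literature.AlgebraicGeometry.Frobenioids.QuasiTemperoid Literature.NumberTheory.GaloisRepresentations

/-! ### §3. `hdesc⊚ ⟺ AutCompatible ι` at every push carrier of a continuous open `ι` -/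

namespace GlobalFrobenioid

universe u

variable {Gq : ProfiniteGrp.{u}} {Δ : GlobalDivisorData Gq} {Dcirc : Type (u + 1)} [Category.{u} Dcirc]
  {toBase0 : Dcirc ⥤ BaseCat Gq} (𝓕 : GlobalFrobenioid Δ Dcirc toBase0)
  {P : Type u} [Group P] [TopologicalSpace P]
  {G : Type u} [Group G] [TopologicalSpace G] [IsTopologicalGroup G] [SecondCountableTopology G]

/-- **The CONVERSE of ★ `hdesc_of_autCompatible`: `hdesc⊚ ⟹ AutCompatible ι`** at the instance `†𝒟^⊚ → †𝒟^⊛ := push ι` (up to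
equivalences `e`, `i` — the data of ★ `hdesc_of_autCompatible`; `G` Galois-countable tempered, `ι` continuous open): if every
self-equivalence of `†𝒟^⊚` descends along `baseMor` (abc-iut-w4-d109's binder `hdesc⊚`), every topological automorphism of `Π` extends
along `ι` up to `Inn(G)` (squares reversed by ★ `CatIsomorphism.nonempty_compat_symm` / ★ `descends_of_equivalences`, then §2).
([IUTchI] Cor 5.3 (i) p.144) [cite: MochizukiSemiAnbd2006, Prop 3.2 p.35] [claim: Mochizuki2012, status: disputed] -/
theorem autCompatible_of_hdesc (hG : IsTempered G) (ι : P →* G) (ho : IsOpenMap ι) (hc : Continuous ι)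
    (e : Dcirc ≌ CosetCat P) (i : BaseCat Gq ≌ CosetCat G) (hinst : toBase0 ⋙ i.functor ≅ e.functor ⋙ CosetCat.push ι ho)
    (hdesc : ∀ Θ : Dcirc ≌ Dcirc, ∃ ΘB : 𝓕.Base ≌ 𝓕.Base, Nonempty (Θ.functor ⋙ 𝓕.baseMor ≅ 𝓕.baseMor ⋙ ΘB.functor)) :
    ∀ φ : P ≃ₜ* P, ∃ (φ₀ : G ≃ₜ* G) (g : G), ∀ x, ι (φ x) = g * φ₀ (ι x) * g⁻¹ := by
  obtain ⟨cA⟩ := CatIsomorphism.nonempty_compat_symm toBase0 𝓕.baseMor 𝓕.α₁ 𝓕.identify 𝓕.compat.symm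
  have h0 : ∀ Θ : Dcirc ≌ Dcirc, ∃ Θ₀ : BaseCat Gq ≌ BaseCat Gq, Nonempty (Θ.functor ⋙ toBase0 ≅ toBase0 ⋙ Θ₀.functor) :=
    CatIsomorphism.descends_of_equivalences 𝓕.baseMor toBase0 𝓕.α₁.symm 𝓕.identify.symm cA hdesc
  obtain ⟨cB⟩ := CatIsomorphism.nonempty_compat_symm (CosetCat.push ι ho) toBase0 e i hinst
  exact CosetCat.autCompatible_of_forall_push_descends hG ι ho hc
    (CatIsomorphism.descends_of_equivalences toBase0 _ e.symm i.symm cB h0)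

/-- **`hdesc⊚ ⟺ AutCompatible ι`** at the instance `†𝒟^⊚ → †𝒟^⊛ := push ι` (data as in ★ `hdesc_of_autCompatible`; `Π` and `G`
Galois-countable tempered topological groups, `ι` continuous open): the displayed LAW of ★ `Cor53iFcircHdescOfAutCompatible` is EXACTLY
the descent binder, not merely sufficient for it. ([IUTchI] Cor 5.3 (i) p.144) [cite: MochizukiSemiAnbd2006, Prop 3.2 p.35] [claim: Mochizuki2012, status: disputed] -/
theorem hdesc_iff_autCompatible [IsTopologicalGroup P] [SecondCountableTopology P] (hP : IsTempered P) (hG : IsTempered G)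
    (ι : P →* G) (ho : IsOpenMap ι) (hc : Continuous ι)
    (e : Dcirc ≌ CosetCat P) (i : BaseCat Gq ≌ CosetCat G) (hinst : toBase0 ⋙ i.functor ≅ e.functor ⋙ CosetCat.push ι ho) :
    (∀ Θ : Dcirc ≌ Dcirc, ∃ ΘB : 𝓕.Base ≌ 𝓕.Base, Nonempty (Θ.functor ⋙ 𝓕.baseMor ≅ 𝓕.baseMor ⋙ ΘB.functor)) ↔
      ∀ φ : P ≃ₜ* P, ∃ (φ₀ : G ≃ₜ* G) (g : G), ∀ x, ι (φ x) = g * φ₀ (ι x) * g⁻¹ :=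
  ⟨𝓕.autCompatible_of_hdesc hG ι ho hc e i hinst, 𝓕.hdesc_of_autCompatible hP ι ho e i hinst⟩

end GlobalFrobenioid

end Literature.IUT.HodgeTheaters
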